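import Summits.ResolutionOfSingularities.ResolutionOfSingularities.Theorems.FrobeniusLadderFInjectiveMacaulayficationGermRowTransport
import Summits.ResolutionOfSingularities.ResolutionOfSingularities.Theorems.FrobeniusLadderFInjectiveMacaulayficationQuotientOriginMaximal
import HarnessLib

/-!
# TRANSPORT OF CENSUS ROWS ALONG POLYNOMIAL COORDINATE CHANGES FIXING THE ORIGIN: a row for `V(φ f)` at the origin is a row for `V(f)` at the origin
# (crux `FInjectiveMacaulayfication` stmt-ResolutionOfSingularities-15315, chain w45a; res-L1-w45a-plan-1 RULINGS R22.2 / R22.4 (2) «(b) the k-algebra automorphism σ_b : z ↦ z + x^b fixes 𝔪 and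
# maps V(f∘σ_b) ≅ V(f) at the origin; (c) class theorem (B′)/(B″) for f∘σ + cover data ⇒ row for V(f)» — first uses: BED T (z ↦ z + 2x⁴, p = 3) and P2d4C (z ↦ z + x⁵); seat
# res-L1-w45a-stub-1 g13; sequel of ✓ `…GermRowTransport` (the generic transport along isomorphisms of germs))

[OURS · L1 W4.5a] Support file (`--supports stmt-ResolutionOfSingularities-15315 --as helper`); def-free; UNCONDITIONAL; no named fact; NOT a statement of any manuscript.
Nothing of the crux is proved. AI-written (AI review is weaker than expert review).

* §1 `map_idealOfVars_le` / `map_idealOfVars_eq` — a `k`-algebra automorphism `φ` of `k[X₀..X_{n−1}]` whose images `φ(Xᵢ)`, `φ⁻¹(Xᵢ)` have no constant term maps the origin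
  ideal `(X₀,…,X_{n−1})` onto itself.
* §2 `exists_quotientEquiv` — for `φ f = g`: a ring isomorphism `τ : k[X]/(g) ≃+* k[X]/(f)` (induced by `φ⁻¹`) mapping the origin ideal onto the origin ideal, with the point
  `(Spec τ)(v′)` again «the origin» whenever `v′` is.
* §3 ★★ `pointFloorRow_of_algEquiv` — THE USE: the census row ⟨LEGAL, NOT FULL, CURED⟩ (`FullCl p`) for the point floor of `V(g) = V(φ f)` at the origin implies the same row for
  the point floor of `V(f)` at the origin (✓ `GermRowTransport.rowShape_of_ringEquiv`); `fInjectivizationGermAt_of_algEquiv` — the germ shape likewise. So «weakly non-degenerate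
  in SOME coordinates of this kind» + cover data for `φ f` gives the row for `f` (the class theorems ✓ p656605 / ✓ p657751 are stated at the origin of the given coordinates).
* §4 `exists_translate` — the instances: `Xⱼ ↦ Xⱼ + c·Xᵢ^b` (`i ≠ j`, `b ≠ 0`), e.g. BED T `z ↦ z + 2x⁴`, P2d4C `z ↦ z + x⁵`.
[folklore; cite: Hartshorne1977, I §1 (affine coordinate changes)] [cite: GortzWedhorn2020, (13.19)]
-/

-- single-problem summit: the doubled namespace component is forced
set_option linter.dupNamespace false

noncomputable section

namespace Summit.ResolutionOfSingularities.ResolutionOfSingularities.Theorems.FInjectiveMacaulayfication.PolyAutRowTransport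

open CategoryTheory CategoryTheory.Limits AlgebraicGeometry TopologicalSpace IsLocalRing MvPolynomial
open Literature.AlgebraicGeometry.Resolution
open Summit.ResolutionOfSingularities.ResolutionOfSingularities.Theorems.FInjectiveMacaulayfication
open SliceableCentre GermForm GermRowTransport

variable (k : Type) [Field k] {n : ℕ}

/-! ## §1 Automorphisms fixing the origin ideal -/

/-- If every `φ(Xᵢ)` has vanishing constant term, `φ` maps the origin ideal into itself. [folklore] -/
theorem map_idealOfVars_le (φ : MvPolynomial (Fin n) k →+* MvPolynomial (Fin n) k) (h : ∀ i : Fin n, constantCoeff (φ (X i)) = 0) :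
    (MvPolynomial.idealOfVars (Fin n) k).map φ ≤ MvPolynomial.idealOfVars (Fin n) k := by
  rw [MvPolynomial.idealOfVars, Ideal.map_span, Ideal.span_le]
  rintro _ ⟨_, ⟨i, rfl⟩, rfl⟩
  exact (QuotientOriginMaximal.mem_idealOfVars_iff k _).mpr (h i)

/-- An automorphism with `φ(Xᵢ)`, `φ⁻¹(Xᵢ)` constant-term-free maps the origin ideal ONTO itself. [folklore] -/
theorem map_idealOfVars_eq (φ : MvPolynomial (Fin n) k ≃+* MvPolynomial (Fin n) k)
    (h₁ : ∀ i : Fin n, constantCoeff (φ (X i)) = 0) (h₂ : ∀ i : Fin n, constantCoeff (φ.symm (X i)) = 0) :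
    (MvPolynomial.idealOfVars (Fin n) k).map φ.toRingHom = MvPolynomial.idealOfVars (Fin n) k := by
  refine le_antisymm (map_idealOfVars_le k φ.toRingHom h₁) fun g hg => ?_
  have hg' : φ.symm.toRingHom g ∈ MvPolynomial.idealOfVars (Fin n) k := map_idealOfVars_le k φ.symm.toRingHom h₂ (Ideal.mem_map_of_mem _ hg)
  have : g = φ.toRingHom (φ.symm.toRingHom g) := (φ.apply_symm_apply g).symm
  rw [this]
  exact Ideal.mem_map_of_mem _ hg'

/-! ## §2 The induced isomorphism of coordinate rings `k[X]/(g) ≃ k[X]/(f)` for `φ f = g` -/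

/-- For `φ f = g` with `φ` fixing the origin ideal: a ring isomorphism `τ : k[X]/(g) ≃+* k[X]/(f)` (induced by `φ⁻¹`) mapping the origin ideal of `k[X]/(g)` onto the origin ideal
of `k[X]/(f)`; consequently `(Spec τ)(v′)` is the origin of `Spec k[X]/(g)` whenever `v′` is the origin of `Spec k[X]/(f)`. [folklore] -/
theorem exists_quotientEquiv (φ : MvPolynomial (Fin n) k ≃+* MvPolynomial (Fin n) k)
    (h₁ : ∀ i : Fin n, constantCoeff (φ (X i)) = 0) (h₂ : ∀ i : Fin n, constantCoeff (φ.symm (X i)) = 0)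
    (f g : MvPolynomial (Fin n) k) (hfg : φ f = g) :
    ∃ τ : (MvPolynomial (Fin n) k ⧸ Ideal.span {g}) ≃+* (MvPolynomial (Fin n) k ⧸ Ideal.span {f}),
      (Ideal.span (Set.range fun j : Fin n => Ideal.Quotient.mk (Ideal.span {g}) (X j))).map τ.toRingHom =
        Ideal.span (Set.range fun j : Fin n => Ideal.Quotient.mk (Ideal.span {f}) (X j)) ∧
      ∀ v' : Spec (.of (MvPolynomial (Fin n) k ⧸ Ideal.span {f})),
        v'.asIdeal = Ideal.span (Set.range fun j : Fin n => Ideal.Quotient.mk (Ideal.span {f}) (X j)) →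
        ((Spec.map (CommRingCat.ofHom τ.toRingHom)).base v').asIdeal = Ideal.span (Set.range fun j : Fin n => Ideal.Quotient.mk (Ideal.span {g}) (X j)) := by
  -- `φ⁻¹` maps `(g)` onto `(f)`
  have hIJ : Ideal.span {f} = (Ideal.span {g}).map (φ.symm : MvPolynomial (Fin n) k →+* MvPolynomial (Fin n) k) := by
    rw [Ideal.map_span, Set.image_singleton]
    congr 1
    rw [Set.singleton_eq_singleton_iff, ← hfg]
    exact (φ.symm_apply_apply f).symm
  let τ : (MvPolynomial (Fin n) k ⧸ Ideal.span {g}) ≃+* (MvPolynomial (Fin n) k ⧸ Ideal.span {f}) := Ideal.quotientEquiv _ _ φ.symm hIJ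
  have hτmk : τ.toRingHom.comp (Ideal.Quotient.mk (Ideal.span {g})) = (Ideal.Quotient.mk (Ideal.span {f})).comp φ.symm.toRingHom := by
    refine RingHom.ext fun q => ?_
    rfl
  have horig : ∀ h : MvPolynomial (Fin n) k, Ideal.span (Set.range fun j : Fin n => Ideal.Quotient.mk (Ideal.span {h}) (X j)) =
      (MvPolynomial.idealOfVars (Fin n) k).map (Ideal.Quotient.mk (Ideal.span {h})) := fun h => by
    rw [MvPolynomial.idealOfVars, Ideal.map_span, ← Set.range_comp]
    rfl
  have hmap : (Ideal.span (Set.range fun j : Fin n => Ideal.Quotient.mk (Ideal.span {g}) (X j))).map τ.toRingHom =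
      Ideal.span (Set.range fun j : Fin n => Ideal.Quotient.mk (Ideal.span {f}) (X j)) := by
    rw [horig g, horig f, Ideal.map_map, hτmk, ← Ideal.map_map, map_idealOfVars_eq k φ.symm h₂ (by simpa using h₁)]
  refine ⟨τ, hmap, fun v' hv' => ?_⟩
  rw [Spec.map_apply, CommRingCat.hom_ofHom, PrimeSpectrum.comap_asIdeal, hv', ← hmap]
  exact Ideal.comap_map_of_bijective τ.toRingHom τ.bijective

/-! ## §3 ★★ Rows and germs along the coordinate change -/

set_option maxHeartbeats 800000 in
-- large statements only
/-- ★★ **A CENSUS ROW FOR `V(φ f)` AT THE ORIGIN IS A CENSUS ROW FOR `V(f)` AT THE ORIGIN** (`φ` a ring automorphism of `k[X]` with `φ(Xᵢ)`, `φ⁻¹(Xᵢ)` constant-term-free,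
e.g. `z ↦ z + 2x⁴`): for every blowing up of `Spec 𝒪_{V(f),v′}` along the point floor — LEGAL ∧ NOT FULL (`¬FullCl p` somewhere over the closed point) ∧ CURED — from the same statement
for `V(g)`, `g = φ f`. [folklore; cite: GortzWedhorn2020, (13.19)] -/
theorem pointFloorRow_of_algEquiv (p : ℕ) (φ : MvPolynomial (Fin n) k ≃+* MvPolynomial (Fin n) k)
    (h₁ : ∀ i : Fin n, constantCoeff (φ (X i)) = 0) (h₂ : ∀ i : Fin n, constantCoeff (φ.symm (X i)) = 0)
    (f g : MvPolynomial (Fin n) k) (hfg : φ f = g)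
    (hrow : ∀ (v : Spec (.of (MvPolynomial (Fin n) k ⧸ Ideal.span {g}))),
      v.asIdeal = Ideal.span (Set.range fun j : Fin n => Ideal.Quotient.mk (Ideal.span {g}) (X j)) →
      ∀ (S' : Scheme.{0}) (g₁ : S' ⟶ Spec ((Spec (.of (MvPolynomial (Fin n) k ⧸ Ideal.span {g}))).presheaf.stalk v)),
        IsBlowup g₁ ((affineBlowup.idealSheaf (Ideal.span (Set.range fun j : Fin n => Ideal.Quotient.mk (Ideal.span {g}) (X j)))).comap
          ((Spec (.of (MvPolynomial (Fin n) k ⧸ Ideal.span {g}))).fromSpecStalk v)) →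
        (((affineBlowup.idealSheaf (Ideal.span (Set.range fun j : Fin n => Ideal.Quotient.mk (Ideal.span {g}) (X j)))).comap
            ((Spec (.of (MvPolynomial (Fin n) k ⧸ Ideal.span {g}))).fromSpecStalk v)) ≠ ⊥ ∧
          ((((affineBlowup.idealSheaf (Ideal.span (Set.range fun j : Fin n => Ideal.Quotient.mk (Ideal.span {g}) (X j)))).comap
            ((Spec (.of (MvPolynomial (Fin n) k ⧸ Ideal.span {g}))).fromSpecStalk v)).support :
              Set (Spec ((Spec (.of (MvPolynomial (Fin n) k ⧸ Ideal.span {g}))).presheaf.stalk v))) ⊆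
            (Scheme.regularLocus (Spec ((Spec (.of (MvPolynomial (Fin n) k ⧸ Ideal.span {g}))).presheaf.stalk v)))ᶜ) ∧
          (∀ s : S', g₁.base s ≠ closedPoint _ → s ∈ Scheme.regularLocus S') ∧ (∀ s : S', CMCl (S'.presheaf.stalk s))) ∧
        (∃ s : S', g₁.base s = closedPoint _ ∧ ¬ FullCl p (S'.presheaf.stalk s)) ∧
        (∃ 𝓚 : S'.IdealSheafData, 𝓚 ≠ ⊥ ∧ (∀ s ∈ (𝓚.support : Set S'), g₁.base s = closedPoint _) ∧
          ∀ (S'' : Scheme.{0}) (π : S'' ⟶ S'), IsBlowup π 𝓚 → ∀ s : S'', FullCl p (S''.presheaf.stalk s))) :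
    ∀ (v' : Spec (.of (MvPolynomial (Fin n) k ⧸ Ideal.span {f}))),
      v'.asIdeal = Ideal.span (Set.range fun j : Fin n => Ideal.Quotient.mk (Ideal.span {f}) (X j)) →
      ∀ (S' : Scheme.{0}) (g₁ : S' ⟶ Spec ((Spec (.of (MvPolynomial (Fin n) k ⧸ Ideal.span {f}))).presheaf.stalk v')),
        IsBlowup g₁ ((affineBlowup.idealSheaf (Ideal.span (Set.range fun j : Fin n => Ideal.Quotient.mk (Ideal.span {f}) (X j)))).comap
          ((Spec (.of (MvPolynomial (Fin n) k ⧸ Ideal.span {f}))).fromSpecStalk v')) →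
        (((affineBlowup.idealSheaf (Ideal.span (Set.range fun j : Fin n => Ideal.Quotient.mk (Ideal.span {f}) (X j)))).comap
            ((Spec (.of (MvPolynomial (Fin n) k ⧸ Ideal.span {f}))).fromSpecStalk v')) ≠ ⊥ ∧
          ((((affineBlowup.idealSheaf (Ideal.span (Set.range fun j : Fin n => Ideal.Quotient.mk (Ideal.span {f}) (X j)))).comap
            ((Spec (.of (MvPolynomial (Fin n) k ⧸ Ideal.span {f}))).fromSpecStalk v')).support :
              Set (Spec ((Spec (.of (MvPolynomial (Fin n) k ⧸ Ideal.span {f}))).presheaf.stalk v'))) ⊆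
            (Scheme.regularLocus (Spec ((Spec (.of (MvPolynomial (Fin n) k ⧸ Ideal.span {f}))).presheaf.stalk v')))ᶜ) ∧
          (∀ s : S', g₁.base s ≠ closedPoint _ → s ∈ Scheme.regularLocus S') ∧ (∀ s : S', CMCl (S'.presheaf.stalk s))) ∧
        (∃ s : S', g₁.base s = closedPoint _ ∧ ¬ FullCl p (S'.presheaf.stalk s)) ∧
        (∃ 𝓚 : S'.IdealSheafData, 𝓚 ≠ ⊥ ∧ (∀ s ∈ (𝓚.support : Set S'), g₁.base s = closedPoint _) ∧
          ∀ (S'' : Scheme.{0}) (π : S'' ⟶ S'), IsBlowup π 𝓚 → ∀ s : S'', FullCl p (S''.presheaf.stalk s)) := by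
  intro v' hv'
  obtain ⟨τ, hmap, horig⟩ := exists_quotientEquiv k φ h₁ h₂ f g hfg
  have h := rowShape_of_ringEquiv p τ v' (Ideal.span (Set.range fun j : Fin n => Ideal.Quotient.mk (Ideal.span {g}) (X j))) (hrow _ (horig v' hv'))
  rw [hmap] at h
  exact h

/-- ★ **The germ shape along the coordinate change**: `FInjectivizationGermAt p` at the origin of `V(φ f)` implies it at the origin of `V(f)`. [folklore] -/
theorem fInjectivizationGermAt_of_algEquiv (p : ℕ) (φ : MvPolynomial (Fin n) k ≃+* MvPolynomial (Fin n) k)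
    (h₁ : ∀ i : Fin n, constantCoeff (φ (X i)) = 0) (h₂ : ∀ i : Fin n, constantCoeff (φ.symm (X i)) = 0)
    (f g : MvPolynomial (Fin n) k) (hfg : φ f = g)
    (hgerm : ∀ v : Spec (.of (MvPolynomial (Fin n) k ⧸ Ideal.span {g})),
      v.asIdeal = Ideal.span (Set.range fun j : Fin n => Ideal.Quotient.mk (Ideal.span {g}) (X j)) → FInjectivizationGermAt p v) :
    ∀ v' : Spec (.of (MvPolynomial (Fin n) k ⧸ Ideal.span {f})),
      v'.asIdeal = Ideal.span (Set.range fun j : Fin n => Ideal.Quotient.mk (Ideal.span {f}) (X j)) → FInjectivizationGermAt p v' := by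
  intro v' hv'
  obtain ⟨τ, -, horig⟩ := exists_quotientEquiv k φ h₁ h₂ f g hfg
  exact fInjectivizationGermAt_of_ringEquiv p τ v' (hgerm _ (horig v' hv'))

/-! ## §4 The instances `Xⱼ ↦ Xⱼ + c·Xᵢ^b` -/

/-- **The elementary coordinate change `Xⱼ ↦ Xⱼ + c·Xᵢ^b` (`i ≠ j`, `b ≠ 0`; all other variables fixed)** is a ring automorphism of `k[X]` with `φ(X_l)`, `φ⁻¹(X_l)` constant-term-free —
the hypotheses of §3 (e.g. BED T `z ↦ z + 2x⁴`, P2d4C `z ↦ z + x⁵`). [folklore] -/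
theorem exists_translate (i j : Fin n) (hij : i ≠ j) (c : k) (b : ℕ) (hb : b ≠ 0) :
    ∃ φ : MvPolynomial (Fin n) k ≃+* MvPolynomial (Fin n) k,
      (∀ q : MvPolynomial (Fin n) k, φ q = aeval (fun l : Fin n => if l = j then X j + C c * X i ^ b else (X l : MvPolynomial (Fin n) k)) q) ∧
      (∀ l : Fin n, constantCoeff (φ (X l)) = 0) ∧ (∀ l : Fin n, constantCoeff (φ.symm (X l)) = 0) := by
  set σ : MvPolynomial (Fin n) k →ₐ[k] MvPolynomial (Fin n) k :=
    aeval (fun l : Fin n => if l = j then X j + C c * X i ^ b else (X l : MvPolynomial (Fin n) k)) with hσ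
  set σ' : MvPolynomial (Fin n) k →ₐ[k] MvPolynomial (Fin n) k :=
    aeval (fun l : Fin n => if l = j then X j - C c * X i ^ b else (X l : MvPolynomial (Fin n) k)) with hσ'
  have hσX : ∀ l : Fin n, σ (X l) = if l = j then X j + C c * X i ^ b else X l := fun l => by rw [hσ, aeval_X]
  have hσ'X : ∀ l : Fin n, σ' (X l) = if l = j then X j - C c * X i ^ b else X l := fun l => by rw [hσ', aeval_X]
  have hσi : σ (X i) = X i := by rw [hσX, if_neg hij]
  have hσ'i : σ' (X i) = X i := by rw [hσ'X, if_neg hij]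
  have h1 : σ.comp σ' = AlgHom.id k _ := by
    refine MvPolynomial.algHom_ext fun l => ?_
    rw [AlgHom.comp_apply, AlgHom.id_apply, hσ'X]
    by_cases hl : l = j
    · rw [if_pos hl, map_sub, map_mul, map_pow, MvPolynomial.algHom_C, MvPolynomial.algebraMap_eq, hσi, hσX, if_pos rfl, hl]
      ring
    · rw [if_neg hl, hσX, if_neg hl]
  have h2 : σ'.comp σ = AlgHom.id k _ := by
    refine MvPolynomial.algHom_ext fun l => ?_
    rw [AlgHom.comp_apply, AlgHom.id_apply, hσX]
    by_cases hl : l = j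
    · rw [if_pos hl, map_add, map_mul, map_pow, MvPolynomial.algHom_C, MvPolynomial.algebraMap_eq, hσ'i, hσ'X, if_pos rfl, hl]
      ring
    · rw [if_neg hl, hσ'X, if_neg hl]
  let φ : MvPolynomial (Fin n) k ≃ₐ[k] MvPolynomial (Fin n) k := AlgEquiv.ofAlgHom σ σ' h1 h2
  have hcc : ∀ (l : Fin n) (ε : MvPolynomial (Fin n) k), ε = C c * X i ^ b ∨ ε = -(C c * X i ^ b) →
      constantCoeff ((if l = j then X j + ε else X l) : MvPolynomial (Fin n) k) = 0 := by
    intro l ε hε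
    by_cases hl : l = j
    · rw [if_pos hl, map_add, constantCoeff_X, zero_add]
      rcases hε with rfl | rfl
      · rw [map_mul, map_pow, constantCoeff_X, zero_pow hb, mul_zero]
      · rw [map_neg, map_mul, map_pow, constantCoeff_X, zero_pow hb, mul_zero, neg_zero]
    · rw [if_neg hl, constantCoeff_X]
  refine ⟨φ.toRingEquiv, fun q => rfl, fun l => ?_, fun l => ?_⟩
  · show constantCoeff (σ (X l)) = 0
    rw [hσX]
    exact hcc l _ (Or.inl rfl)
  · show constantCoeff (σ' (X l)) = 0
    rw [hσ'X, sub_eq_add_neg]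
    exact hcc l _ (Or.inr rfl)

end Summit.ResolutionOfSingularities.ResolutionOfSingularities.Theorems.FInjectiveMacaulayfication.PolyAutRowTransport

end
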